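import Literature.Probability.Percolation.ArmSeparationFourArm
import HarnessLib

/-!
# Positivity of the `k`-arm probabilities at bounded ratio, for ANY number of arms and any colours

Topic: Probability / Percolation; family `crit-perc` (critical site percolation `P = P_{1/2} =
triSitePercolation half` on the triangular lattice `𝕋`; hexagonal annuli `Λ_N ∖ Λ_m`,
`Λ_n = triBall n`, `|·|_𝕋 = triNorm`; the order-free arm events `armEvent κ m N` of
`ArmEvents.lean`, `k` pairwise vertex-disjoint monochromatic self-avoiding paths across the
annulus, and `polyArmProb κ m N = P_{1/2}(armEvent κ m N)`). A brick for the named fact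
`Literature.Probability.Percolation.Nolin2008_prop17_quasiMult` (`FiveArmExponentFacts.lean`;
P. Nolin, *Near-critical percolation in two dimensions*, EJP 13 (2008), §4.5 Prop. 17
[arXiv 0711.4948: Prop. 16]): the bounded-ratio input (ii) of its normal form
`polyArmProb_quasiMult_of_spaced` (`ArmQuasiMultNormalForm.lean`; Nolin's "we may assume
`n₂ ≥ 8 n₁`"), for EVERY number of arms `k` and every colour sequence — the tree had it for
`k ≤ 6` only (`exists_rpow_le_polyArmProb_of_le_six`, six rotated `60°` sectors). Everything here
is PROVED; no definition and no named fact is introduced.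

Nolin (§4.1, before Prop. 14 [arXiv Prop. 13]; item 3 of the list of consequences of RSW): "for
any fixed ratio the probability to observe `j` arms of prescribed colours crossing `S_{n,N}` is
bounded below by a constant depending only on `j` and `N/n`, as soon as `n ≥ n₀(j)`" — here in the
crude form sufficient at bounded ratio: `k` STRAIGHT disjoint parallelograms
`[m, N] × [b_j, b_j + h]`, `b_j = -(j+1)(h+1)`, `h = ⌊m / (2(k+1))⌋`, all inside the closed `60°`
cone `{x₁ ≤ 0 ≤ x₀ + x₁}` over the right sides of the hexagons, where `|·|_𝕋 = x₀`, so that each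
lies in the annulus `{m ≤ |·|_𝕋 ≤ N}` with its left column on `∂Λ_m` and its right column on
`∂Λ_N`; a horizontal crossing of colour `κ j` of the `j`-th one is an arm of colour `κ j`, the `k`
arms are vertex-disjoint, the `k` crossing events are independent (disjoint rows) and each has
probability `P_{1/2}(LR(N - m, h)) ≥ P_{1/2}(LR(4B(k+1) h, h)) ≥ c > 0` by the box-crossing
property at aspect ratio `4B(k+1)` (`N ≤ B m`) and colour exchange at `p = 1/2`.

* `mem_armEvent_of_stripCrossings` — the deterministic statement (via the tree's
  `mem_armEvent_of_disjointPaths`, `ArmSeparationFourArm.lean`);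
* `exists_le_polyArmProb_of_le_mul_any` — **for every `k`, `κ : Fin k → Bool` and ratio `B ≥ 1`
  there is `a > 0` with `a ≤ P_{1/2}(armEvent κ m N)` whenever `2(k+1) ≤ m ≤ N ≤ B m`.**

## References

* P. Nolin, *Near-critical percolation in two dimensions*, Electron. J. Probab. 13 (2008),
  1562–1623, §4.1 (item 3) and Prop. 14 [arXiv 0711.4948: Prop. 13]. [Nolin2008]
* S. Smirnov, W. Werner, *Critical exponents for two-dimensional percolation*, Math. Res. Lett. 8
  (2001), §4.2, p. 9 ("by standard RSW theory"). [SmirnovWernerMRL2001]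
* G. Grimmett, *Percolation*, 2nd ed. (1999), §11.7 (RSW). [GrimmettPercolation1999]

Mathlib: `Finset.prod_le_prod`, `Finset.prod_const`, `Nat` division; no percolation in Mathlib.
Tree: `triStrip`, `triStripFinset`, `coe_triStripFinset`, `triHCross`, `determinedBy_triHCross`,
`triSitePercolation_real_triHCross`, `triLRCrossingProb_anti_width` (`TriRSWChaining.lean`),
`tri_rsw_half_holds` (`TriThetaHalf.lean`), `triNorm_eq_apply_zero` (`ArmEventsAPriori.lean`),
`triSitePercolation_half_real_preimage_colour`, `determinedBy_preimage_colour`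
(`ArmEventsAPrioriPoly.lean`), `mem_armEvent_of_disjointPaths` (`ArmSeparationFourArm.lean`),
`triAnnSet` (`ArmSeparationReroute.lean`), `sitePercolation_real_iInter_eq_prod` (`OneArmLSW.lean`).
-/

noncomputable section

open MeasureTheory Set

namespace Literature.Probability.Percolation

open LatticeModels

/-! ### Straight parallelograms across the annulus inside the right cone -/

/-- A site of a parallelogram `[m, m + L] × [b, b + h]` with `b + h ≤ 0` and `0 ≤ m + b` lies in the
closed cone `{x₁ ≤ 0 ≤ x₀ + x₁}`, where the graph norm is the first coordinate:
`|z|_𝕋 = z₀ ∈ [m, m + L]`. [folklore] -/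
theorem triNorm_eq_of_mem_triStrip_cone {m : ℕ} {b : ℤ} {L h : ℕ} (hb0 : b + h ≤ 0) (hbm : 0 ≤ (m : ℤ) + b)
    {z : Site 2} (hz : z ∈ triStrip (m : ℤ) b L h) : triNorm z = z 0 := by
  rw [mem_triStrip] at hz
  exact triNorm_eq_apply_zero (by omega) (by omega)

/-- **Disjoint straight crossings are disjoint arms.** Let `m ≤ N` and let `b : Fin k → ℤ` be the
bottom rows of `k` parallelograms `[m, N] × [b j, b j + h]` inside the cone (`b j + h ≤ 0 ≤ m + b j`)
occupying pairwise disjoint sets of rows. If for every `j` the configuration read in colour `κ j`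
crosses the `j`-th parallelogram horizontally, then `ω ∈ armEvent κ m N` (each crossing runs inside
`{m ≤ |·|_𝕋 ≤ N}` from `|·|_𝕋 = m` to `|·|_𝕋 = N`; `mem_armEvent_of_disjointPaths`). [cite: Nolin2008, §4.1 item 3 and Prop. 14 (arXiv 0711.4948: Prop. 13)] -/
theorem mem_armEvent_of_stripCrossings {k : ℕ} (κ : Fin k → Bool) {m N h : ℕ} (hmN : m ≤ N)
    (b : Fin k → ℤ) (hb0 : ∀ j, b j + h ≤ 0) (hbm : ∀ j, 0 ≤ (m : ℤ) + b j)
    (hdisj : ∀ i j, i ≠ j → b j + h < b i ∨ b i + h < b j) {ω : SiteConfig (Site 2)}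
    (hω : ∀ j, {v : Site 2 | v ∈ ω ↔ κ j} ∈ triHCross (m : ℤ) (b j) (N - m) h) :
    ω ∈ armEvent κ m N := by
  refine mem_armEvent_of_disjointPaths κ (fun j => triStrip (m : ℤ) (b j) (N - m) h) ?_ ?_
  · intro i j hij
    rw [Set.disjoint_left]
    intro z hzi hzj
    rw [mem_triStrip] at hzi hzj
    rcases hdisj i j hij with h1 | h1 <;> omega
  · intro j
    obtain ⟨x, y, hx, hy, hp⟩ := hω j
    have hxS := hp.left_mem.1
    have hyS := hp.right_mem.1
    refine ⟨x, y, ?_, ?_, hp.mono ?_⟩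
    · rw [triNorm_eq_of_mem_triStrip_cone (hb0 j) (hbm j) hxS, hx]
    · rw [triNorm_eq_of_mem_triStrip_cone (hb0 j) (hbm j) hyS, hy]; omega
    · rintro z ⟨hzS, hzc⟩
      refine ⟨⟨hzS, ?_⟩, hzc⟩
      rw [mem_triAnnSet, triNorm_eq_of_mem_triStrip_cone (hb0 j) (hbm j) hzS]
      rw [mem_triStrip] at hzS
      omega

/-! ### The estimate -/

/-- **Positivity of the `k`-arm probability at bounded ratio, any `k`, any colours** (Nolin 2008,
§4.1, item 3 of the consequences of RSW, and Prop. 14 [arXiv 0711.4948: Prop. 13], lower half, at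
bounded ratio; Smirnov–Werner 2001, §4.2: "by standard RSW theory"): for every `k`,
`κ : Fin k → Bool` and `B ≥ 1` there is `a > 0` (namely `c^k`, `c` the box-crossing constant of
`tri_rsw_half_holds` at aspect ratio `4B(k+1)`) with `a ≤ P_{1/2}(armEvent κ m N)` for all
`2(k+1) ≤ m ≤ N ≤ B m`: with `h = ⌊m / (2(k+1))⌋ ≥ 1`, the `k` parallelograms
`[m, N] × [-(j+1)(h+1), -(j+1)(h+1) + h]` lie in the annulus inside the right cone, are crossed in
colour `κ j` independently with probability `P_{1/2}(LR(N - m, h)) ≥ c` each (`N - m ≤ 4B(k+1) h`;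
colour exchange preserves `P_{1/2}`), and the crossings are `k` disjoint arms
(`mem_armEvent_of_stripCrossings`). The threshold `2(k+1)` is a lattice effect (Nolin's `n₀(j)`). [cite: Nolin2008, §4.1 item 3 and Prop. 14 (arXiv 0711.4948: Prop. 13)] [cite: SmirnovWernerMRL2001, §4.2 (p. 9, "by standard RSW theory")] -/
theorem exists_le_polyArmProb_of_le_mul_any {k : ℕ} (κ : Fin k → Bool) (B : ℕ) (hB : 1 ≤ B) :
    ∃ a : ℝ, 0 < a ∧ ∀ m N : ℕ, 2 * (k + 1) ≤ m → m ≤ N → N ≤ B * m → a ≤ polyArmProb κ m N := by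
  classical
  -- the RSW constant at aspect ratio `ρ = 4 B (k + 1)`
  obtain ⟨ρ, hρ⟩ : ∃ ρ : ℕ, ρ = 4 * B * (k + 1) := ⟨_, rfl⟩
  have hρ1 : 1 ≤ ρ := by
    rw [hρ]; exact le_trans hB (by nlinarith)
  obtain ⟨c, hc, hrsw⟩ := tri_rsw_half_holds (ρ : ℝ) (by exact_mod_cast (lt_of_lt_of_le one_pos hρ1))
  refine ⟨c ^ k, by positivity, fun m N hm hmN hN => ?_⟩
  -- the height `h = ⌊m / (2(k+1))⌋ ≥ 1` of the parallelograms
  obtain ⟨h, hh⟩ : ∃ h : ℕ, h = m / (2 * (k + 1)) := ⟨_, rfl⟩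
  have hk0 : 0 < 2 * (k + 1) := by omega
  have hh1 : 1 ≤ h := by rw [hh]; exact (Nat.le_div_iff_mul_le hk0).2 (by omega)
  have h2h : 2 * (k + 1) * h ≤ m := by rw [hh, Nat.mul_comm]; exact Nat.div_mul_le_self m _
  have hmlt : m < 2 * (k + 1) * h + 2 * (k + 1) := by
    have := Nat.lt_div_mul_add (a := m) hk0; rw [← hh] at this; linarith [Nat.mul_comm h (2 * (k + 1))]
  have hkh : k * (h + 1) ≤ m := by
    have h1 : k * h ≤ (k + 1) * h := Nat.mul_le_mul_right h (Nat.le_succ k)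
    have h2 : 2 * ((k + 1) * h) ≤ m := by rw [← Nat.mul_assoc]; exact h2h
    rw [Nat.mul_add, Nat.mul_one]; omega
  -- the width `N - m ≤ ρ h`
  have hwidth : N - m ≤ ρ * h := by
    have h1 : N ≤ B * m := hN
    have h2 : B * m ≤ B * (2 * (k + 1) * h + 2 * (k + 1)) := Nat.mul_le_mul_left B hmlt.le
    have h3 : B * (2 * (k + 1) * h + 2 * (k + 1)) ≤ ρ * h := by
      rw [hρ]
      have : 2 * (k + 1) * h + 2 * (k + 1) ≤ 4 * (k + 1) * h := by nlinarith
      calc B * (2 * (k + 1) * h + 2 * (k + 1)) ≤ B * (4 * (k + 1) * h) := Nat.mul_le_mul_left B this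
        _ = 4 * B * (k + 1) * h := by ring
    omega
  -- the bottom rows `b j = -(j+1)(h+1)`
  set b : ℕ → ℤ := fun j => -(((j : ℤ) + 1) * ((h : ℤ) + 1)) with hb
  have hb0 : ∀ j : ℕ, b j + h ≤ 0 := fun j => by
    simp only [hb]
    have : (0 : ℤ) ≤ (j : ℤ) * ((h : ℤ) + 1) := by positivity
    nlinarith
  have hbm : ∀ j : ℕ, j < k → 0 ≤ (m : ℤ) + b j := fun j hj => by
    simp only [hb]
    have h1 : ((j : ℤ) + 1) * ((h : ℤ) + 1) ≤ (k : ℤ) * ((h : ℤ) + 1) :=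
      mul_le_mul_of_nonneg_right (by exact_mod_cast hj) (by positivity)
    have h2 : ((k * (h + 1) : ℕ) : ℤ) ≤ m := by exact_mod_cast hkh
    push_cast at h2
    linarith
  have hblt : ∀ i j : ℕ, i < j → b j + h < b i := fun i j hij => by
    simp only [hb]
    have h1 : ((i : ℤ) + 2) * ((h : ℤ) + 1) ≤ ((j : ℤ) + 1) * ((h : ℤ) + 1) :=
      mul_le_mul_of_nonneg_right (by omega) (by positivity)
    nlinarith
  -- the `k` crossing events, read in the colours of `κ`
  set κ' : ℕ → Bool := fun j => if hj : j < k then κ ⟨j, hj⟩ else true with hκ'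
  set Y : ℕ → Set (SiteConfig (Site 2)) := fun j =>
    (fun ω : SiteConfig (Site 2) => {v : Site 2 | v ∈ ω ↔ κ' j}) ⁻¹' triHCross (m : ℤ) (b j) (N - m) h with hY
  have hYdet : ∀ j < k, DeterminedBy (Y j) ↑(triStripFinset (m : ℤ) (b j) (N - m) h) := fun j _ =>
    determinedBy_preimage_colour _ (determinedBy_triHCross _ _ _ _)
  have hFdisj : ∀ i j : ℕ, i < j → j < k →
      Disjoint (triStripFinset (m : ℤ) (b i) (N - m) h) (triStripFinset (m : ℤ) (b j) (N - m) h) := by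
    intro i j hij _
    rw [← Finset.disjoint_coe, coe_triStripFinset, coe_triStripFinset, Set.disjoint_left]
    intro z hzi hzj
    rw [mem_triStrip] at hzi hzj
    have := hblt i j hij
    omega
  have hprod := sitePercolation_real_iInter_eq_prod half (Y := Y) (N := k) hYdet hFdisj
  -- each crossing has probability at least `c`
  have hfloor : ⌊(ρ : ℝ) * h⌋₊ = ρ * h := by
    rw [show (ρ : ℝ) * h = ((ρ * h : ℕ) : ℝ) by push_cast; ring, Nat.floor_natCast]
  have hPY : ∀ j ∈ Finset.range k, c ≤ (sitePercolation (Site 2) half).real (Y j) := by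
    intro j _
    have e1 : (sitePercolation (Site 2) half).real (Y j) =
        (triSitePercolation half).real (triHCross (m : ℤ) (b j) (N - m) h) :=
      triSitePercolation_half_real_preimage_colour (κ' j) _
    rw [e1, triSitePercolation_real_triHCross]
    have h1 : 1 ≤ ⌊(ρ : ℝ) * h⌋₊ := by rw [hfloor]; nlinarith
    calc c ≤ triLRCrossingProb half ⌊(ρ : ℝ) * h⌋₊ h := (hrsw h h1).1
      _ ≤ triLRCrossingProb half (N - m) h := by
          rw [hfloor]; exact triLRCrossingProb_anti_width half hwidth h
  -- the crossings are `k` disjoint arms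
  have hincl : (⋂ j < k, Y j) ⊆ armEvent κ m N := by
    intro ω hω
    simp only [mem_iInter] at hω
    refine mem_armEvent_of_stripCrossings κ hmN (fun j => b j) (fun j => hb0 j) (fun j => hbm j j.2)
      (fun i j hij => ?_) (fun j => ?_)
    · rcases lt_or_gt_of_ne (Fin.val_ne_of_ne hij) with h1 | h1
      · exact Or.inl (hblt i j h1)
      · exact Or.inr (hblt j i h1)
    · have h1 := hω j j.2
      simp only [hY, Set.mem_preimage, hκ', dif_pos j.2] at h1
      exact h1
  -- assemble
  calc c ^ k = ∏ _j ∈ Finset.range k, c := by rw [Finset.prod_const, Finset.card_range]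
    _ ≤ ∏ j ∈ Finset.range k, (sitePercolation (Site 2) half).real (Y j) :=
        Finset.prod_le_prod (fun _ _ => hc.le) hPY
    _ = (sitePercolation (Site 2) half).real (⋂ j < k, Y j) := hprod.symm
    _ ≤ (sitePercolation (Site 2) half).real (armEvent κ m N) := measureReal_mono hincl (measure_ne_top _ _)
    _ = polyArmProb κ m N := rfl

end Literature.Probability.Percolation

end
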